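import Summits.ValiantsHypothesis.ValiantsHypothesis.Theorems.DepthWindowHomSubst
import Literature.Computability.AlgebraicComplexity.DepthThreeChasmGKKSProofs
import Summits.ValiantsHypothesis.ValiantsHypothesis.Theorems.DepthWindowDualityHalving
import Mathlib.Analysis.Complex.Polynomial.Basic
import HarnessLib

/-!
# Route `DepthWindow`, g17 — duality halving I: the sparsity-aware GKKS `ΣΠΣ` form, and truncation

First of five files proving the theorem-input `DualityHalving` of
`Theorems/DepthWindowDualityHalving.lean` (GKKS 2016 §4 duality halving; the theorem is
`dualityHalvingAt_eight` in `Theorems/DepthWindowDualityHalvingProof.lean`).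
§1 `Sparse`: `Literature/…/DepthThreeChasmGKKSProofs.lean` (Gupta–Kamath–Kayal–Saptharishi, *A chasm
at depth three*, SIAM J. Comput. 45 (2016), Lemmas 4.3, 4.4, 4.6, 4.7: Fischer's identity, Saxena's
duality, univariate factoring over the algebraically closed field) proves `isSPS_pow` /
`isSPS_prod_lowdeg` with the count of ALL monomials of degree `≤ t`; duality halving needs the same
two lemmas with the count `|U| · 2^t` for a set `U` of monomials containing the supports (Lemma 4.4 is
stated with the sparsity): `isSPS_pow_sparse`, `isSPS_prod_sparse` (proofs verbatim those of the
Literature file with the one cardinality line changed), and the resulting product-depth-`1` circuit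
with its number of GATES (`exists_circuit_prod_sparse`, from the Literature builder `slotCircuit`).
§2 `Trunc`: `trunc d` = the sum of the homogeneous components of degree `≤ d` (a linear map); on a
homogeneous value it is the value or `0`; a product of homogeneous values that is nonzero of degree
`≤ d` is the product of the truncations (`trunc_list_prod`), and has at most `degree` nonconstant
factors (`length_filter_le_of_prod`).  Everything proved; nothing new mathematically.
[cite: GuptaKamathKayalSaptharishi2016, Lemma 4.3, Lemma 4.4, Lemma 4.6, Lemma 4.7]
[cite: Burgisser2000, Def. 2.1]
-/

-- layout Summits/ValiantsHypothesis/ValiantsHypothesis forces the duplicated namespace component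
set_option linter.dupNamespace false

namespace Summit.ValiantsHypothesis.ValiantsHypothesis.Theorems.DepthWindow

open MvPolynomial Literature.Computability.AlgebraicComplexity ArithCircuit
open Literature.Computability.AlgebraicComplexity.DepthReduction
open Literature.Computability.AlgebraicComplexity.DepthThreeChasm

section Sparse

variable {k : Type*} [Field k] [CharZero k] [IsAlgClosed k]
variable {σ : Type*} [DecidableEq σ] [Inhabited σ]

/-- [GKKS Lemma 4.6/4.7, sparsity-aware] A power `P^w`, `w ≤ W`, of a polynomial of degree `≤ t`
whose support lies in `U` is a sum of at most `(|U| 2^t + 1) W + 1` products of at most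
`|U| 2^t · t · W` affine forms. [cite: GuptaKamathKayalSaptharishi2016, Lemmas 4.4, 4.6 and 4.7] -/
theorem isSPS_pow_sparse {t W : ℕ} (U : Finset (σ →₀ ℕ)) (P : MvPolynomial σ k)
    (hP : P.totalDegree ≤ t) (hPU : P.support ⊆ U) (w : ℕ) (hw : w ≤ W) :
    IsSPS ((U.card * 2 ^ t + 1) * W + 1) (U.card * 2 ^ t * (t * W)) t (P ^ w) := by
  let ι := ↥P.support × Finset (Fin t)
  have hcard : Fintype.card ι ≤ U.card * 2 ^ t := by
    simp only [ι, Fintype.card_prod, Fintype.card_coe, Fintype.card_finset, Fintype.card_fin]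
    exact Nat.mul_le_mul_right _ (Finset.card_le_card hPU)
  set g : ι → MvPolynomial σ k := fun j =>
    (coeff j.1.1 P * fischerCoeff (k := k) (mdeg j.1.1) t j.2) •
      (fischerForm (k := k) j.1.1 t j.2).val ^ (mdeg j.1.1) with hg
  have hPg : P = ∑ j, g j := sparse_fischer P hP
  obtain ⟨β, hβ⟩ := saxena_duality (k := k) g w
  rw [hPg, hβ]
  have hterm : ∀ u : Fin ((Fintype.card ι + 1) * w + 1),
      IsSPS 1 (U.card * 2 ^ t * (t * W)) t (β u • ∏ j, dualFactor (k := k) w u (g j)) := by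
    intro u
    refine (IsSPS.prod_fintype _ fun j => ?_).smul _ |>.mono le_rfl
      (Nat.mul_le_mul_right _ hcard)
    rw [hg]
    apply isSPS_dualFactor
    exact Nat.mul_le_mul ((mdeg_le_totalDegree j.1.2).trans hP) hw
  refine (IsSPS.sum_fintype _ hterm).mono ?_ le_rfl
  rw [Fintype.card_fin, mul_one]
  calc (Fintype.card ι + 1) * w + 1 ≤ (U.card * 2 ^ t + 1) * W + 1 := by
        apply Nat.add_le_add_right
        exact Nat.mul_le_mul (Nat.add_le_add_right hcard 1) hw

/-- [GKKS Lemma 4.3/4.4/4.7, sparsity-aware] A product of `w ≤ W` polynomials of degree `≤ t`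
with supports in `U` is a sum of at most `2^W ((|U| 2^t + 1) W + 1)` products of at most
`|U| 2^t · t · W` affine forms. [cite: GuptaKamathKayalSaptharishi2016, Lemmas 4.3, 4.4 and 4.7] -/
theorem isSPS_prod_sparse {t W : ℕ} (U : Finset (σ →₀ ℕ)) (w : ℕ) (hw : w ≤ W)
    (p : Fin w → MvPolynomial σ k) (hp : ∀ i, (p i).totalDegree ≤ t)
    (hpU : ∀ i, (p i).support ⊆ U) :
    IsSPS (2 ^ W * ((U.card * 2 ^ t + 1) * W + 1)) (U.card * 2 ^ t * (t * W)) t (∏ i, p i) := by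
  have hfis := fischer_ryser (A := MvPolynomial σ k) p Finset.univ
  rw [Finset.card_univ, Fintype.card_fin, Finset.powerset_univ] at hfis
  have hw0 : (w.factorial : k) ≠ 0 := by exact_mod_cast Nat.factorial_ne_zero w
  have hlhs : ∏ i, p i = ((w.factorial : k)⁻¹) • ((w.factorial : MvPolynomial σ k) * ∏ i, p i) := by
    rw [← map_natCast (algebraMap k (MvPolynomial σ k)), ← Algebra.smul_def, smul_smul,
      inv_mul_cancel₀ hw0, one_smul]
  rw [hlhs, hfis]
  refine IsSPS.smul ?_ _
  have hterm : ∀ S : Finset (Fin w),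
      IsSPS ((U.card * 2 ^ t + 1) * W + 1) (U.card * 2 ^ t * (t * W)) t
        ((-1 : MvPolynomial σ k) ^ (w - S.card) * (∑ i ∈ S, p i) ^ w) := by
    intro S
    rw [← map_one (algebraMap k (MvPolynomial σ k)), ← map_neg, ← map_pow, ← Algebra.smul_def]
    refine IsSPS.smul ?_ _
    apply isSPS_pow_sparse U _ _ _ w hw
    · exact totalDegree_finsetSum_le fun i _ => hp i
    · classical
      exact (support_sum (s := S) (f := p)).trans (Finset.biUnion_subset.2 fun i _ => hpU i)
  refine (IsSPS.sum_fintype _ hterm).mono ?_ le_rfl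
  rw [Fintype.card_finset, Fintype.card_fin]
  exact Nat.mul_le_mul_right _ (Nat.pow_le_pow_right (by norm_num) hw)

omit [CharZero k] [IsAlgClosed k] [DecidableEq σ] [Inhabited σ] in
/-- The gate count of the Literature `ΣΠΣ` builder `slotCircuit`: `U · D + U + 1` gates.
[cite: GuptaKamathKayalSaptharishi2016, §1 eq. (1)] -/
theorem size_slotCircuit {t U D : ℕ} (c : Fin U → k) (φ : Fin U → Fin D → AffForm k σ t) :
    (slotCircuit c φ).size = U * D + U + 1 := by
  simp only [slotCircuit, ArithCircuit.size, List.length_append, length_layerF, length_layerQ,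
    List.length_singleton]

omit [CharZero k] [IsAlgClosed k] [DecidableEq σ] [Inhabited σ] in
/-- **A `ΣΠΣ` expression as a product-depth-`1` circuit with a gate count.**
[cite: GuptaKamathKayalSaptharishi2016, §3–§4] -/
theorem exists_circuit_size_of_isSPS {t U D : ℕ} {f : MvPolynomial σ k} (h : IsSPS U D t f) :
    ∃ P : ArithCircuit k σ, P.Computes f ∧ P.productDepth ≤ 1 ∧ P.size = U * D + U + 1 := by
  obtain ⟨c, φ, rfl⟩ := h
  exact ⟨slotCircuit c φ, eval_slotCircuit c φ, productDepth_slotCircuit_le c φ,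
    size_slotCircuit c φ⟩

/-- **The product of `w ≤ W` sparse low-degree polynomials as a small `ΣΠΣ` circuit** (the one
lemma duality halving consumes): a circuit of product-depth `≤ 1` computing `∏ p i` with at most
`(2^W ((|U| 2^t + 1) W + 1)) · (|U| 2^t · t W + 1) + 1` gates.
[cite: GuptaKamathKayalSaptharishi2016, Lemmas 4.3, 4.4, 4.6, 4.7] -/
theorem exists_circuit_prod_sparse {t W : ℕ} (U : Finset (σ →₀ ℕ)) (w : ℕ) (hw : w ≤ W)
    (p : Fin w → MvPolynomial σ k) (hp : ∀ i, (p i).totalDegree ≤ t)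
    (hpU : ∀ i, (p i).support ⊆ U) :
    ∃ P : ArithCircuit k σ, P.Computes (∏ i, p i) ∧ P.productDepth ≤ 1 ∧
      P.size ≤ (2 ^ W * ((U.card * 2 ^ t + 1) * W + 1)) * (U.card * 2 ^ t * (t * W) + 1) + 1 := by
  obtain ⟨P, hPc, hPd, hPs⟩ := exists_circuit_size_of_isSPS (isSPS_prod_sparse U w hw p hp hpU)
  refine ⟨P, hPc, hPd, ?_⟩
  rw [hPs]
  have : (2 ^ W * ((U.card * 2 ^ t + 1) * W + 1)) * (U.card * 2 ^ t * (t * W)) +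
      2 ^ W * ((U.card * 2 ^ t + 1) * W + 1) + 1 =
      (2 ^ W * ((U.card * 2 ^ t + 1) * W + 1)) * (U.card * 2 ^ t * (t * W) + 1) + 1 := by ring
  omega

end Sparse

/-! ### Truncation at degree `d` -/

section Trunc

variable {σ : Type*}

/-- The truncation at degree `d`: the sum of the homogeneous components of degree `≤ d`.
[cite: GuptaKamathKayalSaptharishi2016, §4] -/
noncomputable def trunc (d : ℕ) : MvPolynomial σ ℂ →ₗ[ℂ] MvPolynomial σ ℂ :=
  ∑ e ∈ Finset.range (d + 1), homogeneousComponent e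

/-- Unfolding `trunc`. [folklore] -/
theorem trunc_apply (d : ℕ) (p : MvPolynomial σ ℂ) :
    trunc d p = ∑ e ∈ Finset.range (d + 1), homogeneousComponent e p := by
  simp [trunc, LinearMap.sum_apply]

/-- A homogeneous value of degree `≤ d` is its own truncation. [folklore] -/
theorem trunc_of_isHomogeneous_le {d e : ℕ} {p : MvPolynomial σ ℂ} (hp : p.IsHomogeneous e)
    (he : e ≤ d) : trunc d p = p := by
  rw [trunc_apply]
  simp_rw [homogeneousComponent_of_mem hp]
  rw [Finset.sum_ite_eq' (Finset.range (d + 1)) e (fun _ => p), if_pos]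
  exact Finset.mem_range.mpr (Nat.lt_succ_of_le he)

/-- A homogeneous value of degree `> d` truncates to `0`. [folklore] -/
theorem trunc_of_isHomogeneous_gt {d e : ℕ} {p : MvPolynomial σ ℂ} (hp : p.IsHomogeneous e)
    (he : d < e) : trunc d p = 0 := by
  rw [trunc_apply]
  simp_rw [homogeneousComponent_of_mem hp]
  rw [Finset.sum_ite_eq' (Finset.range (d + 1)) e (fun _ => p), if_neg]
  exact fun h => absurd (Finset.mem_range.mp h) (by omega)

/-- Constants are fixed. [folklore] -/
theorem trunc_C (d : ℕ) (c : ℂ) : trunc d (C c : MvPolynomial σ ℂ) = C c :=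
  trunc_of_isHomogeneous_le (isHomogeneous_C σ c) (Nat.zero_le d)

/-- Variables are fixed once `d ≥ 1`. [folklore] -/
theorem trunc_X {d : ℕ} (hd : 1 ≤ d) (t : σ) : trunc d (X t : MvPolynomial σ ℂ) = X t :=
  trunc_of_isHomogeneous_le (isHomogeneous_X ℂ t) hd

/-- If the truncation of a homogeneous value is nonzero, the value has degree `≤ d`, is nonzero,
and is its own truncation. [folklore] -/
theorem trunc_spec_of_ne_zero {d : ℕ} {p : MvPolynomial σ ℂ} (hp : ∃ e, p.IsHomogeneous e)
    (h : trunc d p ≠ 0) : trunc d p = p ∧ p ≠ 0 ∧ ∃ e ≤ d, p.IsHomogeneous e := by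
  obtain ⟨e, he⟩ := hp
  rcases le_or_gt e d with hle | hgt
  · have h1 := trunc_of_isHomogeneous_le he hle
    exact ⟨h1, fun h0 => h (by rw [h1, h0]), e, hle, he⟩
  · exact absurd (trunc_of_isHomogeneous_gt he hgt) h

/-- A product of homogeneous values is homogeneous. [folklore] -/
theorem exists_isHomogeneous_list_prod (vs : List (MvPolynomial σ ℂ))
    (h : ∀ v ∈ vs, ∃ e, v.IsHomogeneous e) : ∃ e, vs.prod.IsHomogeneous e := by
  induction vs with
  | nil => exact ⟨0, by rw [List.prod_nil]; exact isHomogeneous_one σ ℂ⟩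
  | cons v rest ih =>
      obtain ⟨e₁, h₁⟩ := h v (by simp)
      obtain ⟨e₂, h₂⟩ := ih fun w hw => h w (by simp [hw])
      exact ⟨e₁ + e₂, by rw [List.prod_cons]; exact h₁.mul h₂⟩

/-- **Truncation of a good product.**  If a product of homogeneous values is nonzero and
homogeneous of degree `≤ d`, every factor has degree `≤ d`, so truncating the factors changes
nothing. [folklore] -/
theorem trunc_list_prod {d : ℕ} (vs : List (MvPolynomial σ ℂ))
    (h : ∀ v ∈ vs, ∃ e, v.IsHomogeneous e) {e : ℕ} (he : vs.prod.IsHomogeneous e) (hed : e ≤ d)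
    (hne : vs.prod ≠ 0) : (vs.map (trunc d)).prod = vs.prod := by
  induction vs generalizing e with
  | nil => simp
  | cons v rest ih =>
      obtain ⟨e₁, h₁⟩ := h v (by simp)
      have hrest : ∀ w ∈ rest, ∃ e, w.IsHomogeneous e := fun w hw => h w (by simp [hw])
      obtain ⟨e₂, h₂⟩ := exists_isHomogeneous_list_prod rest hrest
      rw [List.prod_cons] at he hne
      have hr : rest.prod ≠ 0 := right_ne_zero_of_mul hne
      have hsum : e₁ + e₂ = e := (h₁.mul h₂).inj_right he hne
      rw [List.map_cons, List.prod_cons, trunc_of_isHomogeneous_le h₁ (by omega),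
        ih hrest h₂ (by omega) hr, List.prod_cons]

/-- **Counting nonconstant factors.**  In a nonzero homogeneous product of homogeneous values,
the number of factors singled out by a test that forces a nonconstant value is at most the
degree of the product. [folklore] -/
theorem length_filter_le_of_prod {α : Type*} (us : List α) (v : α → MvPolynomial σ ℂ)
    (p : α → Bool) (h : ∀ u ∈ us, ∃ e, (v u).IsHomogeneous e)
    (hP : ∀ u ∈ us, p u = true → (v u).totalDegree ≠ 0) {e : ℕ}
    (he : (us.map v).prod.IsHomogeneous e) (hne : (us.map v).prod ≠ 0) :
    (us.filter p).length ≤ e := by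
  induction us generalizing e with
  | nil => simp
  | cons u rest ih =>
      obtain ⟨e₁, h₁⟩ := h u (by simp)
      have hrest : ∀ w ∈ rest, ∃ e, (v w).IsHomogeneous e := fun w hw => h w (by simp [hw])
      obtain ⟨e₂, h₂⟩ := exists_isHomogeneous_list_prod (rest.map v)
        (fun w hw => by obtain ⟨u', hu', rfl⟩ := List.mem_map.1 hw; exact hrest u' hu')
      rw [List.map_cons, List.prod_cons] at he hne
      have hv : v u ≠ 0 := left_ne_zero_of_mul hne
      have hr : (rest.map v).prod ≠ 0 := right_ne_zero_of_mul hne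
      have hsum : e₁ + e₂ = e := (h₁.mul h₂).inj_right he hne
      have hih := ih hrest (fun w hw => hP w (by simp [hw])) h₂ hr
      rw [List.filter_cons]
      by_cases hPu : p u = true
      · have hdeg : (v u).totalDegree = e₁ := h₁.totalDegree hv
        have hne₁ : e₁ ≠ 0 := by rw [← hdeg]; exact hP u (by simp) hPu
        simp only [hPu, ↓reduceIte, List.length_cons]
        omega
      · simp only [hPu, Bool.false_eq_true, ↓reduceIte]
        omega

end Trunc

end Summit.ValiantsHypothesis.ValiantsHypothesis.Theorems.DepthWindow
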